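/-
Copyright (c) 2026 the pub-hodgecm-mathlib formalisation cell (harness21).  Prover seat hodgecm-mathlib-LH4-p06 (g10) on the K2 VALVE (LEAD F0P6-plan (g16) BATCH #303 (a);
hGnb-CHAIN DESK K2Liu-p23 (g4) WORD #2 DEAL B ∕ WORD #4 (1)), Track B «K2-LIT», #184♮ = hLiu418 = `stmt-HodgeConjecture-24832`; count-neutral helper.
FILE (c-B-2): the growth of a `K₀`-flat Siegel family at the LONG-ROOT TRANSLATE `φ(w₂)·φ(u_{2e₂}(ι y δ))·g` of ★ p863537's stage A, from frame-entry letters.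
THEOREMS ONLY (no `def`, no instance, no notation, no `sorry`).
-/
import Summits.HodgeConjecture.HodgeConjecture.Theorems.K2LiuSiegelSectionGrowthOfEntries   -- ★ (this seat, (c-B-1)): `norm_section_le_of_entries`, `entries_mul_le`
import Summits.HodgeConjecture.HodgeConjecture.Theorems.K2LiuRankOneStageChainValues       -- ★ p863537 (F0P2-p11): the CURRENCY of the point (`FrameTransport.frameConj`, `toLocalFour`, `weylTwo`, `uLongTwo`, `conjLocal_coord`)
import HarnessLib

/-!
# Crux `HLiu418`, the `hGnb` road, brick (c-B-2): «THE GROWTH OF A `K₀`-FLAT SIEGEL FAMILY AT THE LONG-ROOT TRANSLATE» — `‖f_s(φ(w₂)·φ(u_{2e₂}(ι y δ))·g)‖ ≤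
# (∏_{w∣v} (M_κ·(C_W w · C_U w · R w))^{2e})·B` from the entry letters of the two frame elements (`hW`, `hU`) and of `g` (`hg`) — HN2-CENSUS §4 (c-B) at ★ p863537's point

Cell `hodgecm-mathlib`, crux item hLiu418 = `stmt-HodgeConjecture-24832` (lane `--supports … --as helper`, count-neutral), route `HCCMUnconditional`; squad K2 ∕ K2Liu (valve hand from
F0∕P3c∕LH4).  THEOREMS ONLY; ★-only imports; states NO law; the `hGnb` chain and #184♮ stay HYPOTHESES of their consumers.

WHAT (hGnb desk WORD #2 DEAL B «(c-B) `…LongRootBallGrowth :: norm_apply_weylTwo_uLong_le`», WORD #4 (1) «frame-entry letters `hQw hUy` as BINDERS»).  The point of ★ p863537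
`twistedRankOneChain_of_forall_eq` (d′) is `W · U(y) · g` with `W := frameConj Q (toLocalFour (weylTwo))` and `U(y) := frameConj Q (toLocalFour (uLongTwo (ι_v y·δ) …))` in
`H(F_v) = UnitaryGroup.localPi E c (2+2) J₂D v` (spelled VERBATIM as there).  Given entry bounds at each `w ∣ v` for the `w`-components of `W` (`hW : ≤ C_W w`), of `U(y)`
(`hU : ≤ C_U w` — the discharger takes `C_U w := C_Q w · max 1 ‖ι y δ‖_w`, so `‖y‖ ≤ q^k` enters here) and of `g` (`hg : ≤ R w`), all `≥ 1`, the entries of the point are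
`≤ C_W w · C_U w · R w` (★ (c-B-1) `entries_mul_le` twice) and ★ (c-B-1) HEAD `norm_section_le_of_entries` gives the bound.  At the cofinitely many places where the frame `Q` and
`δ` are `w`-unimodular and `K₀ = K_{H,v}`: `C_W = 1`, `C_U = max 1 ‖ι y δ‖_w`, `M_κ = 1`, `B = 1` — the exponent `2e` is place-free (the T₀-split of HN2-CENSUS §3).
* HEAD `norm_apply_weylTwo_uLong_le`.
WHAT IS NOT CLAIMED: the frame-entry letters `hW`, `hU` (the frame lineage F0P2-p11 ∕ K2Liu: entries of `Q_v·M·Q_v⁻¹` at `w` for `M = weylTwoM`, `uLongTwoM (ι y δ)` via ★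
`matS_frameConj`, ★ `matS_toLocalFour`, ★ `coe_component_eq_matS_map`), `M_κ`, `B`, the level∕ball bookkeeping (c-C), the stage assembly (c-D).
HONEST LABEL.  Count-neutral helper; `HC_CM` is proved only modulo the 7 printed citations (2 remaining named inputs: hLiu418 = `stmt-HodgeConjecture-24832`, h413 =
`stmt-HodgeConjecture-24833`) until rung 0 closes.
## References
* [KudlaRallis1994] S. Kudla, S. Rallis, *A regularized Siegel–Weil formula*, Ann. of Math. 140 (1994): §2 (growth of sections along `P·K`).
* [HarrisKudlaSweet1996] M. Harris, S. Kudla, W. J. Sweet, *Theta dichotomy for unitary groups*, J. AMS 9 (1996): §1 (1.11)–(1.15).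
* [Casselman1980] W. Casselman, *The unramified principal series of p-adic groups I*, Compositio Math. 40 (1980): §3.
* [BorelJacquet1979] A. Borel, H. Jacquet, *Automorphic forms and automorphic representations*, PSPM 33.1 (1979): §1.2.
-/

set_option autoImplicit false
set_option linter.dupNamespace false -- the mandated namespace repeats `HodgeConjecture.HodgeConjecture`

noncomputable section

open scoped Matrix Classical NNReal
open NumberField IsDedekindDomain
open Literature.NumberTheory.Automorphic Literature.NumberTheory.Automorphic.UnitaryGroup
open Literature.NumberTheory.GelbartRogawski1991.AdaptedBlocks
open Literature.NumberTheory.GelbartRogawski1991.UnitaryDualPair.LocalSplitting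
open Literature.NumberTheory.K2Lit.LocalSiegelDoubled
open Summit.HodgeConjecture.HodgeConjecture.Cruxes.HLiu418.K2LiuLocalSiegelIwasawaFrame
open Summit.HodgeConjecture.HodgeConjecture.Cruxes.HLiu418.K2LiuLocalSiegelIwasawa
open Summit.HodgeConjecture.HodgeConjecture.Cruxes.HLiu418.K2LiuDoubledUTwoTwoBorelFrame
open Summit.HodgeConjecture.HodgeConjecture.Cruxes.HLiu418.K2LiuDoubledUTwoTwoWeylCocycle
open Summit.HodgeConjecture.HodgeConjecture.Cruxes.HLiu418.K2LiuDoubledUTwoTwoFrameTransport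
open Summit.HodgeConjecture.HodgeConjecture.Cruxes.HLiu418.K2LiuUnipDeltaRankOneCoordinates
open Summit.HodgeConjecture.HodgeConjecture.Cruxes.HLiu418.K2LiuSiegelSectionGrowthOfEntries (norm_section_le_of_entries entries_mul_le)

namespace Summit.HodgeConjecture.HodgeConjecture.Cruxes.HLiu418.K2LiuSiegelSectionLongRootBallGrowth

variable (F : Type) [Field F] [NumberField F] (E : Type) [Field E] [NumberField E] [Algebra F E]
  [Algebra.IsQuadraticExtension F E] (c : E ≃ₐ[F] E)
  {δ : E} (hcδ : c δ = -δ) (hδ : δ ≠ 0) {d : F} (hd : δ * δ = algebraMap F E d) (v : HeightOneSpectrum (𝓞 F))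
  {T₂ : Matrix (Fin 2) (Fin 2) F} (hT₂ : T₂.IsSymm) {J₂D : Matrix (Fin (2 + 2)) (Fin (2 + 2)) E} (hJ₂D : J₂D = (gramD F 2 T₂).map (algebraMap F E))
  (Q : GL (Fin (2 + 2)) F)
  (hQ : (Q : Matrix (Fin (2 + 2)) (Fin (2 + 2)) F)ᵀ * gramD F 2 T₂ * (Q : Matrix (Fin (2 + 2)) (Fin (2 + 2)) F) = (StdForm.antidiagonal (2 + 2)).over F)

include hcδ hδ hd hT₂ in
/-- **HEAD — «THE GROWTH OF A `K₀`-FLAT SIEGEL FAMILY AT THE LONG-ROOT TRANSLATE» (HN2-CENSUS §4 (c-B), ★ p863537's point).**  Frame `(Q, hQ)`; the (c-B-1) data at `n = 2`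
(`χv hχu K₀ hIw Mκ hMκ1 hMκ f hSieg hflat s₀ B hB s hs e he`); a digit `y : F_v`; a point `g` with `w`-entries `≤ R w` (`1 ≤ R w`); the two frame-entry letters `hW` (the `w`-entries of
`W := frameConj Q (toLocalFour weylTwo)` are `≤ C_W w`, `1 ≤ C_W w`) and `hU` (those of `U(y) := frameConj Q (toLocalFour (uLongTwo (ι_v y·δ) …))` are `≤ C_U w`, `1 ≤ C_U w`).  THEN
`‖f s (W * U(y) * g)‖ ≤ (∏_{w∣v} (M_κ · (C_W w · C_U w · R w))^{2·e}) · B`. [cite: KudlaRallis1994, §2] [cite: HarrisKudlaSweet1996, §1 (1.11), (1.15)] [cite: Casselman1980, §3] -/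
theorem norm_apply_weylTwo_uLong_le
    (χv : ∀ w : PlacesOver E v, (w.1.adicCompletion E)ˣ →* ℂˣ) (hχu : ∀ (w : PlacesOver E v) (u : (w.1.adicCompletion E)ˣ), ‖((χv w u : ℂˣ) : ℂ)‖ = 1)
    (K₀ : Subgroup (UnitaryGroup.localPi E c (2 + 2) J₂D v))
    (hIw : ∀ g : UnitaryGroup.localPi E c (2 + 2) J₂D v, ∃ p, IsSiegelDelta F E c hcδ hδ hd v 2 hT₂ hJ₂D p ∧ ∃ k ∈ K₀, g = p * k)
    {Mκ : ℝ} (hMκ1 : 1 ≤ Mκ)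
    (hMκ : ∀ k ∈ K₀, ∀ (w : PlacesOver E v) (a b : Fin (2 + 2)),
      ‖(((k⁻¹ : UnitaryGroup.localPi E c (2 + 2) J₂D v) : UnitaryGroup.LocalGLPi E (2 + 2) v) w : GL (Fin (2 + 2)) (w.1.adicCompletion E)).val a b‖ ≤ Mκ)
    (f : ℂ → UnitaryGroup.localPi E c (2 + 2) J₂D v → ℂ) (hSieg : ∀ s, IsLocalSiegelSection F E c hcδ hδ hd v 2 hT₂ hJ₂D χv s (f s))
    (hflat : ∀ s s' : ℂ, ∀ k ∈ K₀, f s k = f s' k)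
    (s₀ : ℂ) {B : ℝ} (hB : ∀ k ∈ K₀, ‖f s₀ k‖ ≤ B)
    {s : ℂ} (hs : 0 ≤ 2 * s.re + (2 : ℕ)) {e : ℕ} (he : 2 * s.re + (2 : ℕ) ≤ 2 * e)
    (y : v.adicCompletion F) (g : UnitaryGroup.localPi E c (2 + 2) J₂D v) {R : PlacesOver E v → ℝ} (hR : ∀ w, 1 ≤ R w)
    (hg : ∀ (w : PlacesOver E v) (a b : Fin (2 + 2)), ‖(((g : UnitaryGroup.LocalGLPi E (2 + 2) v) w : GL (Fin (2 + 2)) (w.1.adicCompletion E)) : Matrix (Fin (2 + 2)) (Fin (2 + 2)) (w.1.adicCompletion E)) a b‖ ≤ R w)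
    -- the frame-entry letters
    {CW CU : PlacesOver E v → ℝ} (hCW : ∀ w, 1 ≤ CW w) (hCU : ∀ w, 1 ≤ CU w)
    (hW : ∀ (w : PlacesOver E v) (a b : Fin (2 + 2)),
      ‖(((FrameTransport.frameConj F E c v (2 + 2) hJ₂D (antidiagonal_over_eq_map F E 2) Q hQ (toLocalFour F E c v (weylTwo (UnitaryGroup.LocalRing E v) (UnitaryGroup.conjLocal E c v))) :
          UnitaryGroup.LocalGLPi E (2 + 2) v) w : GL (Fin (2 + 2)) (w.1.adicCompletion E)) : Matrix (Fin (2 + 2)) (Fin (2 + 2)) (w.1.adicCompletion E)) a b‖ ≤ CW w)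
    (hU : ∀ (w : PlacesOver E v) (a b : Fin (2 + 2)),
      ‖(((FrameTransport.frameConj F E c v (2 + 2) hJ₂D (antidiagonal_over_eq_map F E 2) Q hQ (toLocalFour F E c v (uLongTwo (UnitaryGroup.LocalRing E v) (UnitaryGroup.conjLocal E c v)
            (UnitaryGroup.toLocalRing E v y * algebraMap E (UnitaryGroup.LocalRing E v) δ) (conjLocal_coord F E c hcδ v y))) :
          UnitaryGroup.LocalGLPi E (2 + 2) v) w : GL (Fin (2 + 2)) (w.1.adicCompletion E)) : Matrix (Fin (2 + 2)) (Fin (2 + 2)) (w.1.adicCompletion E)) a b‖ ≤ CU w) :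
    ‖f s (FrameTransport.frameConj F E c v (2 + 2) hJ₂D (antidiagonal_over_eq_map F E 2) Q hQ (toLocalFour F E c v (weylTwo (UnitaryGroup.LocalRing E v) (UnitaryGroup.conjLocal E c v))) *
        FrameTransport.frameConj F E c v (2 + 2) hJ₂D (antidiagonal_over_eq_map F E 2) Q hQ (toLocalFour F E c v (uLongTwo (UnitaryGroup.LocalRing E v) (UnitaryGroup.conjLocal E c v)
          (UnitaryGroup.toLocalRing E v y * algebraMap E (UnitaryGroup.LocalRing E v) δ) (conjLocal_coord F E c hcδ v y))) * g)‖ ≤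
      (∏ w : PlacesOver E v, (Mκ * (CW w * CU w * R w)) ^ (2 * e)) * B := by
  have hCW0 : ∀ w, 0 ≤ CW w := fun w => zero_le_one.trans (hCW w)
  have hCU0 : ∀ w, 0 ≤ CU w := fun w => zero_le_one.trans (hCU w)
  have hR0 : ∀ w, 0 ≤ R w := fun w => zero_le_one.trans (hR w)
  -- entries of `W * U(y)` and of `(W * U(y)) * g`
  have hWU : ∀ (w : PlacesOver E v) (a b : Fin (2 + 2)),
      ‖((((FrameTransport.frameConj F E c v (2 + 2) hJ₂D (antidiagonal_over_eq_map F E 2) Q hQ (toLocalFour F E c v (weylTwo (UnitaryGroup.LocalRing E v) (UnitaryGroup.conjLocal E c v))) *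
          FrameTransport.frameConj F E c v (2 + 2) hJ₂D (antidiagonal_over_eq_map F E 2) Q hQ (toLocalFour F E c v (uLongTwo (UnitaryGroup.LocalRing E v) (UnitaryGroup.conjLocal E c v)
            (UnitaryGroup.toLocalRing E v y * algebraMap E (UnitaryGroup.LocalRing E v) δ) (conjLocal_coord F E c hcδ v y))) : UnitaryGroup.localPi E c (2 + 2) J₂D v) :
          UnitaryGroup.LocalGLPi E (2 + 2) v) w : GL (Fin (2 + 2)) (w.1.adicCompletion E)) : Matrix (Fin (2 + 2)) (Fin (2 + 2)) (w.1.adicCompletion E)) a b‖ ≤ CW w * CU w :=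
    fun w a b => entries_mul_le F E c v 2 w _ _ (hCW0 w) (hCU0 w) (hW w) (hU w) a b
  have hpt : ∀ (w : PlacesOver E v) (a b : Fin (2 + 2)),
      ‖((((FrameTransport.frameConj F E c v (2 + 2) hJ₂D (antidiagonal_over_eq_map F E 2) Q hQ (toLocalFour F E c v (weylTwo (UnitaryGroup.LocalRing E v) (UnitaryGroup.conjLocal E c v))) *
          FrameTransport.frameConj F E c v (2 + 2) hJ₂D (antidiagonal_over_eq_map F E 2) Q hQ (toLocalFour F E c v (uLongTwo (UnitaryGroup.LocalRing E v) (UnitaryGroup.conjLocal E c v)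
            (UnitaryGroup.toLocalRing E v y * algebraMap E (UnitaryGroup.LocalRing E v) δ) (conjLocal_coord F E c hcδ v y))) * g : UnitaryGroup.localPi E c (2 + 2) J₂D v) :
          UnitaryGroup.LocalGLPi E (2 + 2) v) w : GL (Fin (2 + 2)) (w.1.adicCompletion E)) : Matrix (Fin (2 + 2)) (Fin (2 + 2)) (w.1.adicCompletion E)) a b‖ ≤ CW w * CU w * R w :=
    fun w a b => entries_mul_le F E c v 2 w _ _ (mul_nonneg (hCW0 w) (hCU0 w)) (hR0 w) (hWU w) (hg w) a b
  have hR1 : ∀ w, 1 ≤ CW w * CU w * R w := fun w => one_le_mul_of_one_le_of_one_le (one_le_mul_of_one_le_of_one_le (hCW w) (hCU w)) (hR w)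
  exact norm_section_le_of_entries F E c v 2 hcδ hδ hd hT₂ hJ₂D χv hχu K₀ hIw hMκ1 hMκ f hSieg hflat s₀ hB hs he _ hR1 hpt

end Summit.HodgeConjecture.HodgeConjecture.Cruxes.HLiu418.K2LiuSiegelSectionLongRootBallGrowth

end
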